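import Literature.MathematicalPhysics.QuantumFieldTheory.BalabanImbrieJaffe1984to88.BIJ88SlotFieldGaussBounds

/-!
# `BalabanImbrieJaffe1984to88.BIJ88GaussMultiShell307` — T. Bałaban, J. Imbrie, A. Jaffe, *Effective action and cluster properties of
the abelian Higgs model*, Commun. Math. Phys. **114** (1988) 257–315 [BalabanImbrieJaffe1988]: p. 307 [PDF 51] (Sect. 5.13, the estimate of
`g₂(X_α)`; reused on p. 309 for `g₃`: *"The proof of this estimate is similar to the one for g₂"*) — **ONE GAUSSIAN SHELL FACTOR PER χ-FACTOR
HIT**.  Print, verbatim: *"Functional derivatives hitting χ-factors farther than ½r(e_k) from Λ₉^{(k)} produce factors e^{−cp(e_k)²} after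
integrating with respect to A^{(k)″}, φ^{(k)″}. These derivatives are supported at |A^{(k)″}| ≥ cp(e_k) or |φ^{(k)″}| ≥ cp(e_k) (here we use
the fact that the translation vanishes). Thus we can use the arguments at the end of Sect. 14 in [3] to extract the factors e^{−cp(e_k)²} from
the Gaussian measure."* — factorS, one for EACH χ-factor hit, extracted jointly from ONE Gaussian integral.  The lineage's Gaussian shell files
(`BIJ88GaussIntegration309Law`, `BIJ88GaussShellNoncentred309`, `BIJ88ChiFieldDeriv307`) use only the MARGINAL laws and therefore deliver ONE factor
`e^{−cp²}` for a whole product of shell indicators; THIS FILE proves the joint statement: for a JOINTLY GAUSSIAN family `(X_j)_{j∈J}` whose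
covariance is dominated by `v` TIMES THE IDENTITY (`Var[Σ_j θ_jX_j] ≤ v·Σ_jθ_j²` for all coefficient vectors `θ`) and means `|E X_j| ≤ μ_j`,

  `P{a_j ≤ |X_j| for all j ∈ J} ≤ Π_{j∈J} 2·e^{−a_j(a_j − 2μ_j)/(2v)}`   (`a_j ≥ 0`),

i.e. the probability that ALL the hit χ-factors sit on their shells is the PRODUCT of the one-factor Gaussian tails.  MECHANISM ([3] = Bałaban,
Brydges, Imbrie, Jaffe, Ann. Phys. 158 (1984), Sect. 14 — NOT HELD by the cell, `MISSING-SOURCES.md` S20; the route here is the standard exponential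
Chebyshev one, stated as ours): on the event, `Σ_j (a_j/v)·sgn(X_j)·X_j ≥ Σ_j a_j²/v`; for each of the `2^{|J|}` sign patterns `ε` the variable
`Y_ε = Σ_j (a_j/v)ε_jX_j` is real Gaussian (image of the joint law under a linear form) with `E Y_ε ≤ Σ_j a_jμ_j/v` and, by the covariance letter,
`Var Y_ε ≤ Σ_j a_j²/v`; Chernoff's bound `P{T ≤ Y_ε} ≤ e^{−T + E Y_ε + Var Y_ε/2}` (Mathlib `measure_ge_le_exp_cgf`, `cgf_gaussianReal`) and the
union bound over `ε` give the display.  ON THE CELL'S OBJECTS (§2): under the region law `law(W)` of the §5.13 model (`BIJ88SlotMomentsGauss308.fieldLaw`,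
precision `Δ|_W ≥ m`, source `ℱ`) the LINEAR slot fields `Φ_b(ext ω)` are jointly Gaussian (`BIJ88EffectiveActionGauss308.hasGaussianLaw_slotFields`);
a FRAME LETTER on the slot functionals (`|Σ_b θ_bΦ_b(φ)| ≤ Λ·‖θ‖₂·‖φ‖₂` — e.g. components of the field at distinct sites/bonds, or a bounded
operator such as print's `(I − Q_s*Q)` applied to them) gives the covariance letter with `v = Λ²/m` (`BIJ88SlotFieldGaussBounds.variance_linear_fieldLaw_le`),
and the structural mean bound `|E Φ_b| ≤ ΛF/m` (`…abs_integral_linear_fieldLaw_le`; `F = 0` where *"the translation vanishes"*) feeds `μ_j`: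
`law(W){(9/10)|c_b|p(te_k) ≤ |Φ_b| for all b ∈ B′} ≤ Π_{b∈B′} 2e^{−a_b(a_b − 2ΛF/m)·m/(2Λ²)}`, `a_b = (9/10)|c_b|p(te_k)` — the shell event of EVERY
differentiated χ-slot of `BIJ88SlotFactorsShell309`/`BIJ88ChiMixedDerivN309` at once.

statement-level skeleton of published theorems with citation tags; proofs where landed; nothing here is a claim about the Yang–Mills mass gap

PDF held: `paper:balaban1988-cmp114-bij-abelian-higgs-effective-action` (journal page = PDF page + 256); pages re-read this session as text:
PDF 51 (p. 307) L5–10, PDF 58 (p. 314) reference [3].  NOT held: [3] (Ann. Phys. 158 (1984) 281–319), whose Sect. 14 print invokes.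

CITATION HEADER (lean-in-tree rule).  Part of the lit-balaban TYPED SKELETON (HOME `run/shared/lean/pub/lit-balaban/`), Phase 2, seat p36
(gen 21, unit `lit-balaban-p36`); rows **C2.Eq5.14.3-5.14.4** (member: §f brick 6 — the Gaussian integration step of print's route for the
χ-slots in EVERY cube: after the pointwise bounds of `BIJ88ChiMixedDerivN309` the field dependence of a differentiated term is a product of
shell indicators, one per χ-slot hit, and this file integrates that product) and C2.Claim@307 (member) of `HOME/lit-balaban-r16/ROWS-C2-part2.md`.
WHAT IS REPRODUCED (theorem-only; no definitions, no `Prop` facts; axioms standard):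
* §1 abstract: `setOf_forall_abs_ge_subset` (the sign-pattern covering), `hasGaussianLaw_signedSum` / `integrable_exp_signedSum` (the linear
  images `Y_ε` of the joint law), **`measureReal_forall_abs_ge_le_of_hasGaussianLaw`** (the display) and its centred form
  `measureReal_forall_abs_ge_le_of_hasGaussianLaw_centered` (`Π_j 2e^{−a_j²/(2v)}`);
* §2 on the cell's objects: `isLinearMap_sum_slotFields`, `abs_slotField_le_of_frame`, `frame_of_eval_injective` (the frame letter holds with
  `Λ = 1` for fields read at distinct sites), `variance_sum_slotFields_le` (covariance letter
  `v = Λ²/m` from the frame letter), **`fieldLaw_real_forall_abs_ge_le`** (the display under `law(W)` for thresholds `a_b ≥ 0`) and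
  **`fieldLaw_real_forall_chiShell_le`** (thresholds `(9/10)|c_b|p(te_k)`: the shell events of a set `B′` of linear χ-slot fields).
HONEST SCOPE.  (a) Joint Gaussianity and the covariance letter are essential — with marginal information only, one factor is the truth
(perfectly correlated slots); (b) the frame letter is an explicit hypothesis on the slot functionals, discharged here only for evaluations at distinct sites (`Λ = 1`);
(c) the constant `2` per factor and the exponent `a(a − 2μ)/(2v)` are convenient, not optimal; (d) no (5.14.4), no walk combinatorics.
-/

namespace Literature.MathematicalPhysics.QuantumFieldTheory.BalabanImbrieJaffe1984to88.BIJ88GaussMultiShell307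

open MeasureTheory ProbabilityTheory Finset
open scoped BigOperators

/-! ## §1 The multi-shell bound for a jointly Gaussian family with covariance `≤ v·1` -/

section Abstract

variable {Ω : Type*} [MeasurableSpace Ω] {P : Measure Ω} {κ : Type*} [Fintype κ] [DecidableEq κ] {X : κ → Ω → ℝ}

omit [Fintype κ] [DecidableEq κ] in
/-- the sign of a pattern `ε : κ → Bool` at `i` (`+1` for `true`, `−1` for `false`) squares to `1`. [cite: BalabanImbrieJaffe1988, §5.13 p.307] -/
private theorem sgn_mul_self (ε : κ → Bool) (i : κ) :
    (if ε i then (1 : ℝ) else -1) * (if ε i then (1 : ℝ) else -1) = 1 := by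
  split_ifs <;> norm_num

omit [MeasurableSpace Ω] [DecidableEq κ] in
/-- **the sign-pattern covering**: if `a_i ≤ |X_i(ω)|` for all `i` (`a_i ≥ 0`, `v > 0`) then for the pattern `ε_i = [0 ≤ X_i(ω)]` the signed
sum `Σ_i (a_i/v)ε_iX_i(ω) = Σ_i (a_i/v)|X_i(ω)|` is at least `Σ_i a_i²/v`. [cite: BalabanImbrieJaffe1988, §5.13 p.307] -/
theorem setOf_forall_abs_ge_subset {v : ℝ} (hv : 0 < v) {a : κ → ℝ} (ha : ∀ i, 0 ≤ a i) :
    {ω | ∀ i, a i ≤ |X i ω|} ⊆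
      ⋃ ε : κ → Bool, {ω | ∑ i, a i ^ 2 / v ≤ ∑ i, (a i / v * if ε i then (1 : ℝ) else -1) * X i ω} := by
  intro ω hω
  refine Set.mem_iUnion.2 ⟨fun i => decide (0 ≤ X i ω), ?_⟩
  simp only [Set.mem_setOf_eq]
  refine Finset.sum_le_sum fun i _ => ?_
  have hsgn : (if decide (0 ≤ X i ω) then (1 : ℝ) else -1) * X i ω = |X i ω| := by
    by_cases h : 0 ≤ X i ω
    · rw [decide_eq_true h, if_pos rfl, one_mul, abs_of_nonneg h]
    · rw [decide_eq_false h]; simp [abs_of_neg (not_le.1 h)]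
  rw [mul_assoc, hsgn, pow_two, mul_div_right_comm, div_mul_eq_mul_div, mul_div_right_comm]
  exact mul_le_mul_of_nonneg_left (hω i) (div_nonneg (ha i) hv.le)

omit [DecidableEq κ] in
/-- the signed sums `Y_ε = Σ_i c_iX_i` of a jointly Gaussian family are real Gaussian (image of the joint law under a linear form).
[cite: BalabanImbrieJaffe1988, §5.13 p.307] -/
theorem hasGaussianLaw_signedSum (hJ : HasGaussianLaw (fun ω i => X i ω) P) (c : κ → ℝ) :
    HasGaussianLaw (fun ω => ∑ i, c i * X i ω) P := by
  have h := hJ.map (∑ i, c i • ContinuousLinearMap.proj (R := ℝ) (φ := fun _ : κ => ℝ) i)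
  refine (congrArg (HasGaussianLaw · P) (funext fun ω => ?_)).mp h
  simp [Function.comp, smul_eq_mul]

omit [DecidableEq κ] in
/-- `e^{tY_ε}` is integrable for the Gaussian signed sums. [cite: BalabanImbrieJaffe1988, §5.13 p.307] -/
theorem integrable_exp_signedSum (hJ : HasGaussianLaw (fun ω i => X i ω) P) (c : κ → ℝ) (t : ℝ) :
    Integrable (fun ω => Real.exp (t * ∑ i, c i * X i ω)) P := by
  have hY := hasGaussianLaw_signedSum hJ c
  have h : Integrable (fun x : ℝ => Real.exp (t * x)) (P.map fun ω => ∑ i, c i * X i ω) := by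
    rw [hY.map_eq_gaussianReal]; exact integrable_exp_mul_gaussianReal t
  exact (integrable_map_measure (by fun_prop) hY.aemeasurable).mp h

/-- **ONE GAUSSIAN SHELL FACTOR PER χ-FACTOR HIT** (p. 307: *"Functional derivatives hitting χ-factors … produce factors e^{−cp(e_k)²} after
integrating … These derivatives are supported at |A^{(k)″}| ≥ cp(e_k) … extract the factors e^{−cp(e_k)²} from the Gaussian measure"*): for a
jointly Gaussian real family `(X_i)_{i∈κ}` on a probability space with covariance dominated by `v·1` — `Var[Σ_i θ_iX_i] ≤ v·Σ_iθ_i²` for every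
`θ` (`v > 0`) — and means `|E X_i| ≤ μ_i`, and thresholds `a_i ≥ 0`:
`P{a_i ≤ |X_i| for all i} ≤ Π_i 2·e^{−a_i(a_i − 2μ_i)/(2v)}`. [cite: BalabanImbrieJaffe1988, §5.13 p.307] -/
theorem measureReal_forall_abs_ge_le_of_hasGaussianLaw [IsProbabilityMeasure P] (hJ : HasGaussianLaw (fun ω i => X i ω) P)
    {v : ℝ} (hv : 0 < v) (hvar : ∀ θ : κ → ℝ, Var[fun ω => ∑ i, θ i * X i ω; P] ≤ v * ∑ i, θ i ^ 2)
    {μ : κ → ℝ} (hμ : ∀ i, |P[X i]| ≤ μ i) {a : κ → ℝ} (ha : ∀ i, 0 ≤ a i) :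
    P.real {ω | ∀ i, a i ≤ |X i ω|} ≤ ∏ i, 2 * Real.exp (-(a i * (a i - 2 * μ i) / (2 * v))) := by
  -- the Chernoff bound for one sign pattern
  have hone : ∀ ε : κ → Bool,
      P.real {ω | ∑ i, a i ^ 2 / v ≤ ∑ i, (a i / v * if ε i then (1 : ℝ) else -1) * X i ω} ≤
        Real.exp (∑ i, -(a i * (a i - 2 * μ i) / (2 * v))) := by
    intro ε
    set c : κ → ℝ := fun i => a i / v * if ε i then (1 : ℝ) else -1 with hc
    have hY := hasGaussianLaw_signedSum hJ c
    have hch := measure_ge_le_exp_cgf (μ := P) (X := fun ω => ∑ i, c i * X i ω) (∑ i, a i ^ 2 / v) zero_le_one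
      (integrable_exp_signedSum hJ c 1)
    rw [cgf_gaussianReal hY.map_eq_gaussianReal 1, Real.coe_toNNReal _ (variance_nonneg _ _)] at hch
    refine hch.trans (Real.exp_le_exp.2 ?_)
    -- mean and variance of `Y_ε`
    have hint : ∀ i, Integrable (X i) P := fun i => (hJ.eval i).integrable
    have hmean : P[fun ω => ∑ i, c i * X i ω] = ∑ i, c i * P[X i] := by
      rw [integral_finsetSum _ fun i _ => (hint i).const_mul (c i)]
      exact Finset.sum_congr rfl fun i _ => integral_const_mul _ _
    have hmean_le : P[fun ω => ∑ i, c i * X i ω] ≤ ∑ i, a i / v * μ i := by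
      rw [hmean]
      refine Finset.sum_le_sum fun i _ => ?_
      calc c i * P[X i] ≤ |c i| * |P[X i]| := by rw [← abs_mul]; exact le_abs_self _
        _ ≤ a i / v * μ i := by
            have hci : |c i| = a i / v := by
              simp only [hc]; split_ifs <;> simp [abs_of_nonneg (div_nonneg (ha i) hv.le)]
            rw [hci]; exact mul_le_mul_of_nonneg_left (hμ i) (div_nonneg (ha i) hv.le)
    have hvar_le : Var[fun ω => ∑ i, c i * X i ω; P] ≤ ∑ i, a i ^ 2 / v := by
      refine (hvar c).trans (le_of_eq ?_)
      rw [Finset.mul_sum]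
      refine Finset.sum_congr rfl fun i _ => ?_
      have : c i ^ 2 = (a i / v) ^ 2 := by rw [hc]; dsimp only; rw [mul_pow, pow_two (ite _ _ _), sgn_mul_self, mul_one]
      rw [this]; field_simp
    have hsum : ∑ i, -(a i * (a i - 2 * μ i) / (2 * v)) = -(∑ i, a i ^ 2 / v) + ∑ i, a i / v * μ i + (∑ i, a i ^ 2 / v) / 2 := by
      rw [Finset.sum_div, ← Finset.sum_neg_distrib, ← Finset.sum_add_distrib, ← Finset.sum_add_distrib]
      refine Finset.sum_congr rfl fun i _ => ?_
      field_simp; ring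
    rw [hsum]
    nlinarith [hmean_le, hvar_le]
  -- union bound over the `2^{|κ|}` sign patterns
  calc P.real {ω | ∀ i, a i ≤ |X i ω|}
      ≤ P.real (⋃ ε : κ → Bool, {ω | ∑ i, a i ^ 2 / v ≤ ∑ i, (a i / v * if ε i then (1 : ℝ) else -1) * X i ω}) :=
        measureReal_mono (setOf_forall_abs_ge_subset hv ha)
    _ ≤ ∑ ε : κ → Bool, P.real {ω | ∑ i, a i ^ 2 / v ≤ ∑ i, (a i / v * if ε i then (1 : ℝ) else -1) * X i ω} :=
        measureReal_iUnion_fintype_le _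
    _ ≤ ∑ _ε : κ → Bool, Real.exp (∑ i, -(a i * (a i - 2 * μ i) / (2 * v))) := Finset.sum_le_sum fun ε _ => hone ε
    _ = ∏ i, 2 * Real.exp (-(a i * (a i - 2 * μ i) / (2 * v))) := by
        rw [Finset.sum_const, Finset.card_univ, Fintype.card_fun, Fintype.card_bool, nsmul_eq_mul, Real.exp_sum,
          Finset.prod_mul_distrib, Finset.prod_const, Finset.card_univ]
        push_cast; ring

/-- centred form (*"here we use the fact that the translation vanishes"*): `P{a_i ≤ |X_i| ∀ i} ≤ Π_i 2e^{−a_i²/(2v)}` when `E X_i = 0`.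
[cite: BalabanImbrieJaffe1988, §5.13 p.307] -/
theorem measureReal_forall_abs_ge_le_of_hasGaussianLaw_centered [IsProbabilityMeasure P]
    (hJ : HasGaussianLaw (fun ω i => X i ω) P) {v : ℝ} (hv : 0 < v)
    (hvar : ∀ θ : κ → ℝ, Var[fun ω => ∑ i, θ i * X i ω; P] ≤ v * ∑ i, θ i ^ 2) (h0 : ∀ i, P[X i] = 0)
    {a : κ → ℝ} (ha : ∀ i, 0 ≤ a i) :
    P.real {ω | ∀ i, a i ≤ |X i ω|} ≤ ∏ i, 2 * Real.exp (-(a i ^ 2 / (2 * v))) := by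
  have h := measureReal_forall_abs_ge_le_of_hasGaussianLaw hJ hv hvar (μ := fun _ => 0) (fun i => by rw [h0, abs_zero]) ha
  refine h.trans (le_of_eq (Finset.prod_congr rfl fun i _ => ?_))
  rw [mul_zero, sub_zero, pow_two]

end Abstract

/-! ## §2 On the cell's objects: the shell events of the linear χ-slot fields under the law of a region -/

section Region

open Matrix
open BIJ88PolymerRep5134Gauss (ext prec src)
open BIJ88SlotMomentsGauss308 (fieldLaw)
open BIJ88Eq5145CornerModel (prec_corner_posDef)
open BIJ88Sect2Statements (pLog)

variable {α I : Type} [Fintype α] [DecidableEq α] [Fintype I] [DecidableEq I]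
  (blk : α → I) (Δ : Matrix α α ℝ) (ℱ : α → ℝ) (W : Finset I)
variable {ι : Type*} (B' : Finset ι) {Φ : ι → (α → ℝ) → ℝ}

omit [Fintype α] [DecidableEq α] [Fintype I] [DecidableEq I] in
/-- a finite linear combination of linear slot fields is a linear slot field. [cite: BalabanImbrieJaffe1988, (5.14.2) p.308] -/
theorem isLinearMap_sum_slotFields (hlin : ∀ b ∈ B', IsLinearMap ℝ (Φ b)) (θ : ↥B' → ℝ) :
    IsLinearMap ℝ fun φ : α → ℝ => ∑ b : ↥B', θ b * Φ b φ := by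
  refine ⟨fun φ ψ => ?_, fun r φ => ?_⟩
  · rw [← Finset.sum_add_distrib]
    exact Finset.sum_congr rfl fun b _ => by rw [(hlin b b.2).map_add]; ring
  · rw [Finset.smul_sum]
    exact Finset.sum_congr rfl fun b _ => by rw [(hlin b b.2).map_smul]; simp only [smul_eq_mul]; ring

omit [DecidableEq α] [Fintype I] [DecidableEq I] in
/-- the FRAME LETTER at a single slot: `|Φ_b(φ)| ≤ Λ‖φ‖₂` (take `θ = δ_b`). [cite: BalabanImbrieJaffe1988, (5.14.2) p.308] -/
theorem abs_slotField_le_of_frame [DecidableEq ι] {Λ : ℝ}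
    (hframe : ∀ (θ : ↥B' → ℝ) (φ : α → ℝ), |∑ b : ↥B', θ b * Φ b φ| ≤ Λ * Real.sqrt (∑ b : ↥B', θ b ^ 2) * Real.sqrt (φ ⬝ᵥ φ))
    (b : ↥B') (φ : α → ℝ) : |Φ b φ| ≤ Λ * Real.sqrt (φ ⬝ᵥ φ) := by
  have h := hframe (Pi.single b 1) φ
  have h1 : ∑ b' : ↥B', (Pi.single b (1 : ℝ) : ↥B' → ℝ) b' * Φ b' φ = Φ b φ := by
    rw [Finset.sum_eq_single b (fun b' _ hb' => by rw [Pi.single_eq_of_ne hb', zero_mul]) (fun hb => absurd (Finset.mem_univ b) hb),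
      Pi.single_eq_same, one_mul]
  have h2 : ∑ b' : ↥B', (Pi.single b (1 : ℝ) : ↥B' → ℝ) b' ^ 2 = 1 := by
    rw [Finset.sum_eq_single b (fun b' _ hb' => by rw [Pi.single_eq_of_ne hb']; ring) (fun hb => absurd (Finset.mem_univ b) hb),
      Pi.single_eq_same, one_pow]
  rw [h1, h2, Real.sqrt_one, mul_one] at h
  exact h

omit [Fintype I] [DecidableEq I] in
/-- **the frame letter is not vacuous**: slot fields that read the field at DISTINCT sites (`Φ_b(φ) = φ(x_b)`, `x` injective — components of
`A^{(k)}`, `φ^{(k)}` at distinct bonds/sites) satisfy it with `Λ = 1` (Cauchy–Schwarz). [cite: BalabanImbrieJaffe1988, (5.14.2) p.308] -/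
theorem frame_of_eval_injective (x : ↥B' → α) (hx : Function.Injective x) (θ : ↥B' → ℝ) (φ : α → ℝ) :
    |∑ b : ↥B', θ b * φ (x b)| ≤ 1 * Real.sqrt (∑ b : ↥B', θ b ^ 2) * Real.sqrt (φ ⬝ᵥ φ) := by
  have hcs := BIJ88SlotFieldGaussBounds.abs_dotProduct_le_sqrt_mul_sqrt θ (fun b => φ (x b))
  have hsub : (fun b : ↥B' => φ (x b)) ⬝ᵥ (fun b => φ (x b)) ≤ φ ⬝ᵥ φ := by
    have himg : ∑ b : ↥B', φ (x b) * φ (x b) = ∑ y ∈ Finset.univ.image x, φ y * φ y := by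
      rw [Finset.sum_image (f := fun y => φ y * φ y) fun b _ b' _ h => hx h]
    calc (fun b : ↥B' => φ (x b)) ⬝ᵥ (fun b => φ (x b)) = ∑ y ∈ Finset.univ.image x, φ y * φ y := himg
      _ ≤ ∑ y, φ y * φ y := Finset.sum_le_sum_of_subset_of_nonneg (Finset.subset_univ _) fun y _ _ => mul_self_nonneg _
  have hθ : θ ⬝ᵥ θ = ∑ b : ↥B', θ b ^ 2 := Finset.sum_congr rfl fun b _ => (pow_two _).symm
  rw [one_mul, ← hθ]
  exact hcs.trans (mul_le_mul_of_nonneg_left (Real.sqrt_le_sqrt hsub) (Real.sqrt_nonneg _))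

/-- **THE COVARIANCE LETTER FROM THE FRAME LETTER**: under `law(W)` (`Δ ≥ m·1`, `m > 0`), linear slot fields with
`|Σ_b θ_bΦ_b(φ)| ≤ Λ‖θ‖₂‖φ‖₂` satisfy `Var[Σ_b θ_bΦ_b(ext ω)] ≤ (Λ²/m)·Σ_bθ_b²` (`BIJ88SlotFieldGaussBounds.variance_linear_fieldLaw_le` for the
combination). [cite: BalabanImbrieJaffe1988, p.304 (Sect. 5.13); (5.14.2) p.308] -/
theorem variance_sum_slotFields_le (hΔ : Δ.PosDef) {m : ℝ} (hm : 0 < m) (hΔm : ∀ φ : α → ℝ, m * (φ ⬝ᵥ φ) ≤ φ ⬝ᵥ (Δ *ᵥ φ))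
    (hlin : ∀ b ∈ B', IsLinearMap ℝ (Φ b)) {Λ : ℝ} (hΛ : 0 ≤ Λ)
    (hframe : ∀ (θ : ↥B' → ℝ) (φ : α → ℝ), |∑ b : ↥B', θ b * Φ b φ| ≤ Λ * Real.sqrt (∑ b : ↥B', θ b ^ 2) * Real.sqrt (φ ⬝ᵥ φ))
    (θ : ↥B' → ℝ) :
    Var[fun ω => ∑ b : ↥B', θ b * Φ b (ext blk W ω); fieldLaw blk Δ ℱ W] ≤ Λ ^ 2 / m * ∑ b : ↥B', θ b ^ 2 := by
  have hθ : 0 ≤ ∑ b : ↥B', θ b ^ 2 := Finset.sum_nonneg fun b _ => sq_nonneg _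
  have h := BIJ88SlotFieldGaussBounds.variance_linear_fieldLaw_le blk Δ ℱ W hΔ hm hΔm (isLinearMap_sum_slotFields B' hlin θ)
    (Λ := Λ * Real.sqrt (∑ b : ↥B', θ b ^ 2)) (by positivity) (fun φ => hframe θ φ)
  refine h.trans (le_of_eq ?_)
  rw [mul_pow, Real.sq_sqrt hθ]; ring

/-- **ONE SHELL FACTOR PER χ-SLOT UNDER THE LAW OF A REGION** (p. 307 on the §5.13 model): under `law(W)` (`Δ ≥ m·1`, `m > 0`, source
`‖ℱ|_W‖₂ ≤ F`), for linear slot fields `Φ_b`, `b ∈ B′`, obeying the frame letter with constant `Λ > 0`, and thresholds `a_b ≥ 0`: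
`law(W){a_b ≤ |Φ_b(ext ω)| for all b ∈ B′} ≤ Π_{b∈B′} 2·e^{−a_b(a_b − 2ΛF/m)/(2Λ²/m)}` — jointly Gaussian slot fields
(`BIJ88EffectiveActionGauss308.hasGaussianLaw_slotFields`), covariance letter `v = Λ²/m` (`variance_sum_slotFields_le`), mean letter `ΛF/m`
(`BIJ88SlotFieldGaussBounds.abs_integral_linear_fieldLaw_le`; `F = 0` where *"the translation vanishes"*), and §1.
[cite: BalabanImbrieJaffe1988, §5.13 p.307, (5.14.3)–(5.14.4) p.309] -/
theorem fieldLaw_real_forall_abs_ge_le [DecidableEq ι] (hΔ : Δ.PosDef) {m : ℝ} (hm : 0 < m)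
    (hΔm : ∀ φ : α → ℝ, m * (φ ⬝ᵥ φ) ≤ φ ⬝ᵥ (Δ *ᵥ φ)) (hlin : ∀ b ∈ B', IsLinearMap ℝ (Φ b)) {Λ : ℝ} (hΛ : 0 < Λ)
    (hframe : ∀ (θ : ↥B' → ℝ) (φ : α → ℝ), |∑ b : ↥B', θ b * Φ b φ| ≤ Λ * Real.sqrt (∑ b : ↥B', θ b ^ 2) * Real.sqrt (φ ⬝ᵥ φ))
    {F : ℝ} (hF0 : 0 ≤ F) (hF : src blk ℱ W ⬝ᵥ src blk ℱ W ≤ F ^ 2) {a : ↥B' → ℝ} (ha : ∀ b, 0 ≤ a b) :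
    (fieldLaw blk Δ ℱ W).real {ω | ∀ b : ↥B', a b ≤ |Φ b (ext blk W ω)|} ≤
      ∏ b : ↥B', 2 * Real.exp (-(a b * (a b - 2 * (Λ * F / m)) / (2 * (Λ ^ 2 / m)))) := by
  have hPD := prec_corner_posDef blk Δ hΔ W W
  have hJ := BIJ88EffectiveActionGauss308.hasGaussianLaw_slotFields blk Δ ℱ W (B := B') hPD hlin
  haveI := hJ.isProbabilityMeasure
  exact measureReal_forall_abs_ge_le_of_hasGaussianLaw (X := fun (b : ↥B') ω => Φ b (ext blk W ω)) hJ (by positivity)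
    (variance_sum_slotFields_le blk Δ ℱ W B' hΔ hm hΔm hlin hΛ.le hframe)
    (fun b => BIJ88SlotFieldGaussBounds.abs_integral_linear_fieldLaw_le blk Δ ℱ W hΔ hm hΔm (hlin b b.2) hΛ.le
      (abs_slotField_le_of_frame B' hframe b) hF0 hF) ha

/-- **… for the χ-SHELLS of the located slots** (thresholds `a_b = (9/10)|c_b|p(te_k)` of `BIJ88SlotFactorsShell309` / `BIJ88ChiMixedDerivN309`):
`law(W){(9/10)|c_b|p(te_k) ≤ |Φ_b(ext ω)| for all b ∈ B′} ≤ Π_{b∈B′} 2·e^{−a_b(a_b − 2ΛF/m)·m/(2Λ²)}` — one Gaussian shell factor for EACH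
differentiated χ-slot, as print counts them. [cite: BalabanImbrieJaffe1988, §5.13 p.307, (5.14.3)–(5.14.4) p.309] -/
theorem fieldLaw_real_forall_chiShell_le [DecidableEq ι] (hΔ : Δ.PosDef) {m : ℝ} (hm : 0 < m)
    (hΔm : ∀ φ : α → ℝ, m * (φ ⬝ᵥ φ) ≤ φ ⬝ᵥ (Δ *ᵥ φ)) (hlin : ∀ b ∈ B', IsLinearMap ℝ (Φ b)) {Λ : ℝ} (hΛ : 0 < Λ)
    (hframe : ∀ (θ : ↥B' → ℝ) (φ : α → ℝ), |∑ b : ↥B', θ b * Φ b φ| ≤ Λ * Real.sqrt (∑ b : ↥B', θ b ^ 2) * Real.sqrt (φ ⬝ᵥ φ))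
    {F : ℝ} (hF0 : 0 ≤ F) (hF : src blk ℱ W ⬝ᵥ src blk ℱ W ≤ F ^ 2) (c : ι → ℝ) (p : ℝ) {ek t : ℝ} (hek : 0 < ek) (ht : 0 < t)
    (h1 : t * ek < 1) :
    (fieldLaw blk Δ ℱ W).real {ω | ∀ b : ↥B', 9 / 10 * (|c b| * pLog p (t * ek)) ≤ |Φ b (ext blk W ω)|} ≤
      ∏ b : ↥B', 2 * Real.exp (-(9 / 10 * (|c b| * pLog p (t * ek)) * (9 / 10 * (|c b| * pLog p (t * ek)) - 2 * (Λ * F / m)) /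
        (2 * (Λ ^ 2 / m)))) := by
  have hP : 0 ≤ pLog p (t * ek) := by
    rw [BIJ88ChiTDeriv309.pLog_eq_rpow_neg_log p (mul_pos ht hek) h1]
    exact Real.rpow_nonneg (by have := Real.log_neg (mul_pos ht hek) h1; linarith) p
  exact fieldLaw_real_forall_abs_ge_le blk Δ ℱ W B' hΔ hm hΔm hlin hΛ hframe hF0 hF (a := fun b => 9 / 10 * (|c b| * pLog p (t * ek)))
    fun b => by positivity

end Region

end Literature.MathematicalPhysics.QuantumFieldTheory.BalabanImbrieJaffe1984to88.BIJ88GaussMultiShell307
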